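/-
Copyright (c) 2026 the pub-hodgecm-mathlib formalisation cell (harness21).  Prover seat hodgecm-mathlib-LH4-p05 (g4), req620 Track A «(D-RAM) FOUR-FRAME» squad
(unit U3_Laws, (KSS) road under the (R-22) «κS-RECUT»: (iv) THE Ω-GENERIC Fκ6-2 HEAD OF RECORD `kappaSignModelSum2_of_kappaStageB_complete (Ω)`; heir LEAD F0P3a-plan (g19) T18-53
ORDER OF SHAPE (Q1 = OPTION A in LH4-p10 (g3)'s schedule-parameter typing; Q5 = symmetric units, same factor on both vertex types), dealer LH4-plan (g12) WORD #1 (4)(iv) ∕ WORD #2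
(2)(a)(c) ∕ WORD #3 (1) ∕ WORD #4 (3), SHAPE MEMO v1 `F0/P3c/LH4/LH4-plan/g11/KS-RECUT-SHAPE-MEMO.v1` §2∕§3 (iv); schedule type = ★ `OmegaSchedule` (LH4-p10 (g3) (ii) p856987, spelled out) and KSS² spelling = LH4-p10 (g3)'s (iii) cand v2
1af5ce5b5e6913a9 `hKSS`, token for token).  2026-09-04.
-/
import Summits.HodgeConjecture.HodgeConjecture.Theorems.F0P3cDyRamKappaSignModelSumTokenOfKappaStageB   -- ★ (this seat, g4): THE ENGINE `kappaSignModelSum_of_kappaStageB_token (S)` — the (KSS)-shaped reduction modulo κ-Stage B for an ARBITRARY sign token; brings ★ (Oκ2c)₀, ★ p856175, ★ №1-R, the DEFS leaves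
import HarnessLib

/-!
# Crux `H413`, line LH4 «(D-RAM) FOUR-FRAME» road — unit U3_Laws (iii), (KSS) road under (R-22) «κS-RECUT»: (iv) THE Ω-GENERIC Fκ6-2 HEAD OF RECORD
# `kappaSignModelSum2_of_kappaStageB_complete (Ω) (hAκ2) (hBκS20) (hBκS20₂)` — the re-lettered signed eightfold κ-model sum (KSS²) modulo κ-Stage B, for an ARBITRARY
# sign-token schedule `Ω : (K; σ, ϖ, d, a, b, i) ↦ ℤ` (★ `OmegaSchedule`)

Cell `hodgecm-mathlib` (D-0151), FLOOR 0, crux item H413 = `stmt-HodgeConjecture-24833`, route of record `HCCMUnconditional`; squad F0∕P3c∕LH4 (req618∕req620).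
THEOREMS ONLY (no `def`, no instance, no notation, no `sorry`, default heartbeats); lane `--supports stmt-HodgeConjecture-24833` (count-neutral).

WHY.  ★ `F0P3cDyRamKappaSignModelSumOfKappaStageB.kappaSignModelSum_of_kappaStageB_complete` (p856605 ∕ ED. 2 p856683, LH4-p05 (g3)) reduces the registered (KSS) sentence
`stub_U3_kappaSignModelSum` (U3 ED. 10 :592) to κ-Stage A₂ and the two SIGNED κ-Stage-B sums (κS-B₀)∕(κS-B₂) (:509∕:524) whose sign token is `w_i·S_i`, `w = (ω(−1), ω(−1), 1)`,
`S_i = baseSign σ i · ω(fPartProd δ (a,b,1) i)`.  Under (R-22) those two children are, AS ∀-K SENTENCES, model-refuted — (κS-B₂) at the census cell of record e2b `(d,t) = (4,4)`,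
`e_F = 2` (REF5 (g22) R5-114 (B), ref4 R4-129), (κS-B₀) at `(6,8)`, `e_F = 4` (R5-109 (3), LH4-r01 (g4) GD∕GD2, LHref-N #343∕`cft68.py`) — and heir LEAD T18-53 ORDERS the sign half
of U3 RE-LETTERED Ω-AWARE: the honest token carries a factor `Ω_i` (the glue sign of the norm-one unit `(b, a, b∕a)_i`, ★ p856880 (R0)(R1)(R2)), typed as a SCHEDULE PARAMETER
`Ω : ∀ (K : Type) [Field K] [Valued K ℤᵐ⁰], (K →+* K) → K → ℕ → K → K → Fin 3 → ℤ` (★ LH4-p10 (g3)'s `OmegaSchedule`, DEFS LEAF №1-R2 p856987: `KappaSignLawAtS2 shift Ω`,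
`KappaSignLawAtR2 Ω`; `K` explicit, no `t`, token `Ω K σ ϖ d a b i`), the schedule of record `ΩR` being LH4-p04 (g2)'s glue sign (★ leaf (i) `…DiagonalGlueSignDefs` p856975: `ΩR K σ ϖ d a b i = glueSignR σ ϖ d a b i`).  THIS FILE is
prerequisite (iv) of the ORDER: the Fκ6-2 head that PAYS the re-lettered parent `stub_U3_kappaSignModelSum2` (KSS²) BY COMPOSITION from (κ-A₂) and the two re-lettered children
(κS-B₀²)∕(κS-B₂²), for an ARBITRARY schedule `Ω` — so it imports NO Ω definition and is independent of leaf (i) (T18-53 sequencing; dealer WORD #2 (2)(a)).  Its (KSS²) conclusion,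
after the fence binders, is LH4-p10 (g3)'s transport-head binder `hKSS` of `dyadicFence_kappaSignLawAtR2_of_kappaSignModelSum2_8 (Ω)` TOKEN FOR TOKEN, so U3 ED. 11b composes
`stub_U3_kappaSignModelSum2 := kappaSignModelSum2_of_kappaStageB_complete ΩR (κ-A₂) (κS-B₀²) (κS-B₂²)` and `stub_U3_kappaSignLawR2 := fun σ ϖ d t h2 hD =>
dyadicFence_kappaSignLawAtR2_of_kappaSignModelSum2_8 ΩR σ ϖ d t (stub_U3_kappaSignModelSum2 σ ϖ d t h2 hD) h2 hD` with the children spelling the factor as the applied constant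
`ΩR K σ ϖ d a b i` (WORD #2 (2)(b): never unfolded) — constant applications only, no β.

THE MATHEMATICS.  None beyond the ★ engine: the reduction is token-blind linear algebra over `ℚ` after κ-Stage A (`8·(S·A∕4) = 2·S·A`), proved once in
★ `…KappaSignModelSumTokenOfKappaStageB` for an arbitrary token `S : (σ, ϖ, d, t, δ, a, b, i) ↦ ℤ`; here `S := fun σ ϖ d t δ a b i => Ω K σ ϖ d a b i * (w_i * S_i)`.
HOME certificates (by paste∕path, rc 0): `F0/P3c/LH4/LH4-p05/g4/TokenEngine.TIE-ED2.v1.LH4p05g4.lean` (★ ED. 2's head = the engine at the ED. 10 token, by name) and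
`…/ED11b.rehearsal.v2.LH4p05g4.lean` (the ED. 11b composition above over LH4-p04 (g2)'s leaf cand and a schedule constant of record: elaborates, `sorries` = the two children exactly,
by-name type tie `type_of% @(head ΩR) = ((κ-A₂) → (κS-B₀²) → (κS-B₂²) → KSS²)` by `rfl`).

WHAT IS PROVED.
* `kappaSignModelSum2_of_kappaStageB_complete (Ω) (hAκ2) (hBκS20) (hBκS20₂)` — (iv) THE Fκ6-2 HEAD OF RECORD, Ω-GENERIC: (KSS²) = the registered KSS sentence (U3 ED. 10 :592)
  with the sign of BOTH conjuncts multiplied by `Ω K σ ϖ d a b i`, from `hAκ2` = (κ-A₂) `stub_U3_kappaStageA_typeTwo_mult` VERBATIM and the two re-lettered children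
  (κS-B₀²)∕(κS-B₂²) = the ED. 10 (κS-B₀)∕(κS-B₂) sentences (`[CompleteSpace K]` on every K-binder) with RHS sign `Ω K σ ϖ d a b i * (w_i * S_i)`.
HONEST LABEL.  Count-neutral (`--supports`); CONDITIONAL on PROVER TARGETS (κ-Stage A₂ is ★ p856633; the re-lettered κ-Stage-B sums are census laws in model currency — targets,
never literature facts); nothing printed is asserted and no `def … : Prop` is introduced; `HC_CM` is proved only modulo the 7 printed citations (2 remaining named inputs:
hLiu418 = `stmt-HodgeConjecture-24832`, h413 = `stmt-HodgeConjecture-24833`) until rung 0 closes.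

## References
* [Kottwitz1986BaseChangeUnits] R. E. Kottwitz, *Base change for unit elements of Hecke algebras*, Compositio Math. 60 (1986), §1 pp. 240–241 (κ-orbital integrals of units as
  signed lattice counts modulo the torus).
* [Rogawski1990] J. D. Rogawski, *Automorphic Representations of Unitary Groups in Three Variables*, Ann. of Math. Stud. 123 (1990), §4.9 Prop. 4.9.1 (a) p. 55, §4.10 p. 58.
* [LanglandsShelstad1987] R. P. Langlands, D. Shelstad, *On the definition of transfer factors*, Math. Ann. 278 (1987), §3.
-/

set_option autoImplicit false

noncomputable section

namespace Summit.HodgeConjecture.HodgeConjecture.Cruxes.H413.F0P3cDyRamKappaSignModelSum2OfKappaStageB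

open scoped Valued WithZero Matrix MatrixGroups
open Literature.NumberTheory.Automorphic Literature.NumberTheory.Automorphic.HermitianLattice
  Literature.NumberTheory.Automorphic.UnitaryLatticeTree Literature.NumberTheory.Automorphic.UnitaryThreeFourFrame
open Summit.HodgeConjecture.HodgeConjecture.Cruxes.H413.F0P3cDyRamFourFrameLawDefs
open Summit.HodgeConjecture.HodgeConjecture.Cruxes.H413.F0P3cDyRamFourFrameLawDefsR
open Summit.HodgeConjecture.HodgeConjecture.Cruxes.H413.F0P3cDyRamDiagonalTorusDefs
open Summit.HodgeConjecture.HodgeConjecture.Cruxes.H413.F0P3cDyRamDiagonalStrataDefs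
open Summit.HodgeConjecture.HodgeConjecture.Cruxes.H413.F0P3cDyRamDiagonalKappaCountDefs
open Summit.HodgeConjecture.HodgeConjecture.Cruxes.H413.F0P3cDyRamKappaSignModelSumTokenOfKappaStageB (kappaSignModelSum_of_kappaStageB_token)

/-- **(KSS²) MODULO COMPLETE-FIELD κ-STAGE B — (iv) THE Ω-GENERIC Fκ6-2 HEAD OF RECORD.**  For ANY sign-token schedule
`Ω : ∀ (K : Type) [Field K] [Valued K ℤᵐ⁰], (K →+* K) → K → ℕ → K → K → Fin 3 → ℤ` (★ LH4-p10 (g3)'s `OmegaSchedule` p856987 spelled out; of record the glue-sign schedule `ΩR` over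
LH4-p04 (g2)'s ★ leaf (i) p856975, `ΩR K σ ϖ d a b i = glueSignR σ ϖ d a b i = glueSign σ ϖ d ((b, a, b∕a)_i)`): from `hAκ2` = the registered (κ-A₂) `stub_U3_kappaStageA_typeTwo_mult` VERBATIM (κ-Stage A at type 2 with
multiplicity) and the two RE-LETTERED SIGNED κ-STAGE-B SUMS at the square element datum `(a², b²)` over COMPLETE valued fields with finite residue field (`[CompleteSpace K]`
load-bearing, REF5 R5-96∕97) — `hBκS20` (type 0: `Σᶠ_{M ∈ 𝓛₀(T), IsDualisableLattice} kappaCount σ ϖ 0 i M · stabiliserWeight σ M = Ω_i·w_i·S_i·ampl q k B ∕ 4`,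
`Ω_i = Ω K σ ϖ d a b i`, `w = (ω(−1), ω(−1), 1)`, `S_i = baseSign σ i · ω(fPartProd δ (a,b,1) i)`) and `hBκS20₂` (type 2, over `IsTypeTwoPolarisable`, `kappaCount σ ϖ 2`,
`B + tauOfRecord d`) — the (KSS²) sentence: behind the dyadic fence both eightfold signed model sums equal `2·(Ω_i·w_i·S_i)·ampl` (at `B`, resp. `B + tauOfRecord d`), the SAME
factor `Ω_i` on both vertex types (T18-53 Q5, REF5 R5-115 (3)).  The conclusion after the fence is LH4-p10 (g3)'s `hKSS` binder of
`dyadicFence_kappaSignLawAtR2_of_kappaSignModelSum2_8 Ω σ ϖ d t` token for token.  Proof: the ★ engine at `S := fun σ ϖ d t δ a b i => Ω K σ ϖ d a b i * (w_i * S_i)`.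
[cite: Kottwitz1986BaseChangeUnits, §1 pp. 240–241] [cite: Rogawski1990, §4.9 Prop. 4.9.1 (a) p. 55, §4.10 p. 58] [cite: LanglandsShelstad1987, §3] -/
theorem kappaSignModelSum2_of_kappaStageB_complete
    (Ω : ∀ (K : Type) [Field K] [Valued K ℤᵐ⁰], (K →+* K) → K → ℕ → K → K → Fin 3 → ℤ)
    (hAκ2 : ∀ {K : Type} [Field K] [Valued K ℤᵐ⁰] [Finite 𝓀[K]] {σ : K →+* K}, (∀ x, σ (σ x) = x) → (∀ a, Valued.v (σ a) = Valued.v a) →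
      ∀ {ϖ : K}, Valued.v ϖ = WithZero.exp (-1 : ℤ) → ∀ (ϖu : Kˣ), (ϖu : K) = ϖ →
      ∀ {c : K}, σ c = c → Valued.v c = 1 → (¬ ∃ z : K, z * σ z = c) →
        (∀ x : K, σ x = x → x ≠ 0 → (∃ z : K, z * σ z = x) ∨ ∃ z : K, z * σ z = c * x) →
      ∀ {s : Fin 3 → K}, (∀ i, Valued.v (s i) = 1) → (∀ i j, i ≠ j → s i ≠ s j) →
      ∀ (T : GL (Fin 3) K), (T : Matrix (Fin 3) (Fin 3) K) = Matrix.diagonal s → ∀ (i : Fin 3),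
        (((∑ e : Fin 3 → Bool,
            (![(if e 1 then -1 else 1) * (if e 2 then -1 else 1),
               (if e 0 then -1 else 1) * (if e 2 then -1 else 1),
               (if e 0 then -1 else 1) * (if e 1 then -1 else 1)] : Fin 3 → ℤ) i *
              ({M : Submodule 𝒪[K] (Fin 3 → K) |
                IsVertexLattice σ ϖ (Matrix.diagonal fun j => if e j then c else (1 : K)) 2 M ∧ mapGL T M = M}.ncard : ℤ) : ℤ) : ℚ)) =
          8 * ∑ᶠ M₀ ∈ {M : Submodule 𝒪[K] (Fin 3 → K) | M ∈ normalisedStableLattices T ∧ IsTypeTwoPolarisable σ ϖ M},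
            (kappaCount σ ϖ 2 i M₀ : ℚ) * stabiliserWeight σ M₀)
    (hBκS20 : ∀ {K : Type} [Field K] [Valued K ℤᵐ⁰] [CompleteSpace K] [Fintype 𝓀[K]] {σ : K →+* K} {ϖ : K} {d t : ℕ}, IsRamifiedQuadraticDatum σ ϖ d t →
      Valued.v (2 : K) < 1 → ∀ {δ : K}, σ δ = -δ → δ ≠ 0 →
      ∀ {a b : K}, a * σ a = 1 → b * σ b = 1 → Valued.v (a - 1) < Valued.v (2 : K) → Valued.v (b - 1) < Valued.v (2 : K) →
      ∀ {n₁ n₂ n₃ : ℕ}, IsElementDatum σ ϖ (depthOfRecord d) (a * a) (b * b) n₁ n₂ n₃ →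
      ∀ (T : GL (Fin 3) K), (T : Matrix (Fin 3) (Fin 3) K) = Matrix.diagonal ![a * a, b * b, 1] → ∀ (k : ℕ), 2 * k + d = n₁ + n₂ + n₃ + 2 →
      ∀ (i : Fin 3) (B : ℤ), 2 * B = ((![n₁, n₂, n₃] : Fin 3 → ℕ) i : ℤ) - d + 2 - 2 * shiftR d t →
        ∑ᶠ M ∈ {M : Submodule 𝒪[K] (Fin 3 → K) | M ∈ normalisedStableLattices T ∧ IsDualisableLattice σ ϖ M},
            (kappaCount σ ϖ 0 i M : ℚ) * stabiliserWeight σ M =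
          ((Ω K σ ϖ d a b i * ((![normSign σ (-1 : K), normSign σ (-1 : K), 1] : Fin 3 → ℤ) i *
            (baseSign σ i * normSign σ (fPartProd δ ![a, b, 1] i))) : ℤ) : ℚ) * ampl (Fintype.card 𝓀[K]) k B / 4)
    (hBκS20₂ : ∀ {K : Type} [Field K] [Valued K ℤᵐ⁰] [CompleteSpace K] [Fintype 𝓀[K]] {σ : K →+* K} {ϖ : K} {d t : ℕ}, IsRamifiedQuadraticDatum σ ϖ d t →
      Valued.v (2 : K) < 1 → ∀ {δ : K}, σ δ = -δ → δ ≠ 0 →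
      ∀ {a b : K}, a * σ a = 1 → b * σ b = 1 → Valued.v (a - 1) < Valued.v (2 : K) → Valued.v (b - 1) < Valued.v (2 : K) →
      ∀ {n₁ n₂ n₃ : ℕ}, IsElementDatum σ ϖ (depthOfRecord d) (a * a) (b * b) n₁ n₂ n₃ →
      ∀ (T : GL (Fin 3) K), (T : Matrix (Fin 3) (Fin 3) K) = Matrix.diagonal ![a * a, b * b, 1] → ∀ (k : ℕ), 2 * k + d = n₁ + n₂ + n₃ + 2 →
      ∀ (i : Fin 3) (B : ℤ), 2 * B = ((![n₁, n₂, n₃] : Fin 3 → ℕ) i : ℤ) - d + 2 - 2 * shiftR d t →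
        ∑ᶠ M ∈ {M : Submodule 𝒪[K] (Fin 3 → K) | M ∈ normalisedStableLattices T ∧ IsTypeTwoPolarisable σ ϖ M},
            (kappaCount σ ϖ 2 i M : ℚ) * stabiliserWeight σ M =
          ((Ω K σ ϖ d a b i * ((![normSign σ (-1 : K), normSign σ (-1 : K), 1] : Fin 3 → ℤ) i *
            (baseSign σ i * normSign σ (fPartProd δ ![a, b, 1] i))) : ℤ) : ℚ) * ampl (Fintype.card 𝓀[K]) k (B + tauOfRecord d) / 4) :
    ∀ {K : Type} [Field K] [Valued K ℤᵐ⁰] [CompleteSpace K] [Fintype 𝓀[K]] (σ : K →+* K) (ϖ : K) (d t : ℕ),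
      DyadicFence (K := K) (IsRamifiedQuadraticDatum σ ϖ d t →
        ∀ c : K, σ c = c → Valued.v c = 1 → (∀ x : K, σ x = x → x ≠ 0 → (∃ z : K, z * σ z = x) ∨ ∃ z : K, z * σ z = c * x) →
        ∀ (δ : K), σ δ = -δ → δ ≠ 0 →
        ∀ (a b : K), a * σ a = 1 → b * σ b = 1 → Valued.v (a - 1) < Valued.v (2 : K) → Valued.v (b - 1) < Valued.v (2 : K) →
        ∀ (n₁ n₂ n₃ : ℕ), IsElementDatum σ ϖ (depthOfRecord d) (a * a) (b * b) n₁ n₂ n₃ →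
        ∀ (T : GL (Fin 3) K), (T : Matrix (Fin 3) (Fin 3) K) = Matrix.diagonal ![a * a, b * b, 1] →
        ∀ (k : ℕ), 2 * k + d = n₁ + n₂ + n₃ + 2 →
        ∀ (i : Fin 3) (B : ℤ), 2 * B = ((![n₁, n₂, n₃] : Fin 3 → ℕ) i : ℤ) - d + 2 - 2 * shiftR d t →
          ((∑ s : Fin 3 → Bool,
              (![(if s 1 then -1 else 1) * (if s 2 then -1 else 1),
                 (if s 0 then -1 else 1) * (if s 2 then -1 else 1),
                 (if s 0 then -1 else 1) * (if s 1 then -1 else 1)] : Fin 3 → ℤ) i *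
                ({M : Submodule 𝒪[K] (Fin 3 → K) |
                  IsVertexLattice σ ϖ (Matrix.diagonal fun j => if s j then c else (1 : K)) 0 M ∧ mapGL T M = M}.ncard : ℤ) : ℤ) : ℚ) =
            2 * ((Ω K σ ϖ d a b i * ((![normSign σ (-1 : K), normSign σ (-1 : K), 1] : Fin 3 → ℤ) i *
            (baseSign σ i * normSign σ (fPartProd δ ![a, b, 1] i))) : ℤ) : ℚ) * ampl (Fintype.card 𝓀[K]) k B ∧
          ((∑ s : Fin 3 → Bool,
              (![(if s 1 then -1 else 1) * (if s 2 then -1 else 1),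
                 (if s 0 then -1 else 1) * (if s 2 then -1 else 1),
                 (if s 0 then -1 else 1) * (if s 1 then -1 else 1)] : Fin 3 → ℤ) i *
                ({M : Submodule 𝒪[K] (Fin 3 → K) |
                  IsVertexLattice σ ϖ (Matrix.diagonal fun j => if s j then c else (1 : K)) 2 M ∧ mapGL T M = M}.ncard : ℤ) : ℤ) : ℚ) =
            2 * ((Ω K σ ϖ d a b i * ((![normSign σ (-1 : K), normSign σ (-1 : K), 1] : Fin 3 → ℤ) i *
            (baseSign σ i * normSign σ (fPartProd δ ![a, b, 1] i))) : ℤ) : ℚ) * ampl (Fintype.card 𝓀[K]) k (B + tauOfRecord d)) :=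
  kappaSignModelSum_of_kappaStageB_token
    (fun {K} _ _ _ _ σ ϖ d _ δ a b i => Ω K σ ϖ d a b i * ((![normSign σ (-1), normSign σ (-1), 1] : Fin 3 → ℤ) i * (baseSign σ i * normSign σ (fPartProd δ ![a, b, 1] i))))
    hAκ2 hBκS20 hBκS20₂

end Summit.HodgeConjecture.HodgeConjecture.Cruxes.H413.F0P3cDyRamKappaSignModelSum2OfKappaStageB

end
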